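import Summits.ABC.StewartYu.PadicG3Slab
import Summits.ABC.StewartYu.PadicTwistPMRoots
import HarnessLib

/-!
# Cell abc-stewartyu, crux `Y07Odd` (stmt-ABC-19658), line `gen3-slab-odd`: the LINEAR FORM and the ORDER — `‖Λ‖_p = p^{−ord_p(∏ αⱼ^{bⱼ} − 1)}`
# (when this order is positive), hence `‖Λ/b_{j₀}‖ ≤ p^{−k}` as soon as `ord_p(∏α^b − 1) ≥ k + ord_p(b_{j₀})`

`Summits/ABC/StewartYu/PadicG3Lambda.lean` — cell `abc-stewartyu` (seat p2-g4, F-odd lead).  Theorems on `G3Setup`; no named fact.  For the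
twisted generators `ω_j = α_j η_j` (principal units): `Λ = Σ b_j log ω_j = log ∏ ω_j^{b_j}` (`plog_prod_zpow`), `∏ ω^b = cls(b)·∏ α^b`
(`prod_ω_zpow`); if `∏ α^b` is itself a principal unit then the root of unity `cls(b)`, being principal, is `1`
(`PadicTwistPMRoots.eq_one_of_pow_eq_one_of_principal`), so `Λ = log ∏α^b` and `‖Λ‖ = ‖∏α^b − 1‖` (`norm_plog`).  This is the link
between FrameOdd's negated bound on `ord_p(∏α^b − 1)` and the analytic smallness `‖Λ/b_{j₀}‖ ≤ p^{−(m+1)}` used by the frame.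

* `Λ_eq_plog_prod`, `cls_b_eq_one_of_principal`, `norm_Λ_eq`, **`norm_Λ_div_le_of_padicValRat`**.

References: K. Yu, Compositio 74 (1990) Lemma 1.2, (2.17)–(2.19); Acta Math. 211 (2013) §7.
-/

noncomputable section

open NormedSpace Finset
open Literature.NumberTheory.Transcendental

namespace Summit.ABC.StewartYu

namespace G3Setup

variable {p : ℕ} [Fact p.Prime] (S : G3Setup p)

/-- `Λ = log_p ∏ⱼ ωⱼ^{bⱼ}`. [cite: Yu1990, (2.19)] -/
theorem Λ_eq_plog_prod : S.Λ = PadicExp.plog (∏ j, S.ω j ^ S.b j) := by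
  unfold Λ lg
  rw [PadicExp.plog_prod_zpow (ℓ := p) univ (fun j => S.ω j) S.b fun j _ => lt_of_le_of_lt (S.norm_one_sub_ω_le j) S.inv_p_lt_one]

/-- `∏ ω^b = cls(b) · ∏ α^b`. [folklore] -/
theorem prod_ω_b : ∏ j, S.ω j ^ S.b j = S.cls S.b * ((∏ j, S.α j ^ S.b j : ℚ) : ℚ_[p]) := by
  have h := S.prod_ω_zpow S.b 1
  simp only [mul_one, zpow_one] at h
  exact h

/-- **If `∏ α^b` is a principal unit then `cls(b) = 1`** (a principal root of unity is `1`). [cite: Yu1990, Lemma 1.2; shape only] -/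
theorem cls_b_eq_one_of_principal (hprin : ‖((∏ j, S.α j ^ S.b j : ℚ) : ℚ_[p]) - 1‖ ≤ (p : ℝ)⁻¹) : S.cls S.b = 1 := by
  have hp : p.Prime := Fact.out
  set u : ℚ_[p] := ((∏ j, S.α j ^ S.b j : ℚ) : ℚ_[p]) with hu
  have hu1 : ‖u‖ = 1 := IwasawaLog.norm_eq_one_of_norm_one_sub_lt (by rw [norm_sub_rev]; exact lt_of_le_of_lt hprin S.inv_p_lt_one)
  have hu0 : u ≠ 0 := fun h0 => by rw [h0, norm_zero] at hu1; exact zero_ne_one hu1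
  -- `cls b = ∏ω^b / u` is principal
  have hω : ‖(∏ j, S.ω j ^ S.b j) - 1‖ ≤ (p : ℝ)⁻¹ := by
    rw [norm_sub_rev]
    exact PadicExp.norm_one_sub_prod_zpow_le (inv_nonneg.mpr S.p_pos.le) S.inv_p_lt_one univ (fun j => S.ω j) S.b
      (fun j _ => S.norm_one_sub_ω_le j)
  have hcls : S.cls S.b = (∏ j, S.ω j ^ S.b j) * u⁻¹ := by
    rw [S.prod_ω_b, mul_assoc, mul_inv_cancel₀ hu0, mul_one]
  have hprin' : ‖S.cls S.b - 1‖ ≤ (p : ℝ)⁻¹ := by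
    -- `xy⁻¹ − 1 = (x − 1) y⁻¹ + (y⁻¹ − 1)`… simpler: `‖x u⁻¹ − 1‖ = ‖x − u‖ / ‖u‖ = ‖(x − 1) − (u − 1)‖ ≤ max`
    rw [hcls]
    have : (∏ j, S.ω j ^ S.b j) * u⁻¹ - 1 = ((∏ j, S.ω j ^ S.b j - 1) + -(u - 1)) * u⁻¹ := by
      field_simp
      ring
    rw [this, norm_mul, norm_inv, hu1, inv_one, mul_one]
    refine (IsUltrametricDist.norm_add_le_max _ _).trans (max_le hω ?_)
    rw [norm_neg]; exact hprin
  exact TwistExistsAnyOrder.eq_one_of_pow_eq_one_of_principal S.hp3 hprin' (by have := S.hp3; omega : 0 < p - 1) (S.cls_pow S.b)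

/-- **`‖Λ‖ = ‖∏ α^b − 1‖`** when `∏ α^b` is a principal unit. [cite: Yu1990, Lemma 1.2] -/
theorem norm_Λ_eq (hprin : ‖((∏ j, S.α j ^ S.b j : ℚ) : ℚ_[p]) - 1‖ ≤ (p : ℝ)⁻¹) :
    ‖S.Λ‖ = ‖((∏ j, S.α j ^ S.b j : ℚ) : ℚ_[p]) - 1‖ := by
  rw [S.Λ_eq_plog_prod, S.prod_ω_b, S.cls_b_eq_one_of_principal hprin, one_mul,
    PadicExp.norm_plog S.hp3 (by rw [norm_sub_rev]; exact hprin), norm_sub_rev]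

/-- **The analytic smallness from the order**: if `ord_p(∏ α^b − 1) ≥ k + ord_p(b_{j₀})` with `k ≥ 1` (and `∏ α^b ≠ 1`), then
`‖Λ / b_{j₀}‖ ≤ p^{−k}`. [cite: Yu2013, §7; shape only] -/
theorem norm_Λ_div_le_of_padicValRat {k : ℕ} (hk : 1 ≤ k) (hne : ∏ j, S.α j ^ S.b j ≠ 1)
    (hord : (k : ℤ) + padicValInt p (S.b S.j₀) ≤ padicValRat p (∏ j, S.α j ^ S.b j - 1)) :
    ‖S.Λ / (S.b S.j₀ : ℚ_[p])‖ ≤ (p : ℝ)⁻¹ ^ k := by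
  have hp : p.Prime := Fact.out
  have hp1 : (1 : ℝ) < p := by exact_mod_cast hp.one_lt
  set q : ℚ := ∏ j, S.α j ^ S.b j - 1 with hq
  have hq0 : q ≠ 0 := sub_ne_zero.mpr hne
  -- `‖q‖_p = p^{−ord_p q}`
  have hnq : ‖(q : ℚ_[p])‖ = (p : ℝ) ^ (-padicValRat p q) := by
    rw [Padic.norm_eq_zpow_neg_valuation (by exact_mod_cast hq0), Padic.valuation_ratCast]
  have hv0 : 0 ≤ padicValInt p (S.b S.j₀) := by unfold padicValInt; exact_mod_cast Nat.zero_le _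
  have hordq : (1 : ℤ) ≤ padicValRat p q := by rw [hq]; linarith
  -- `∏α^b` is a principal unit
  have hcast : ((∏ j, S.α j ^ S.b j : ℚ) : ℚ_[p]) - 1 = (q : ℚ_[p]) := by rw [hq]; push_cast; ring
  have hprin : ‖((∏ j, S.α j ^ S.b j : ℚ) : ℚ_[p]) - 1‖ ≤ (p : ℝ)⁻¹ := by
    rw [hcast, hnq]
    calc (p : ℝ) ^ (-padicValRat p q) ≤ (p : ℝ) ^ (-1 : ℤ) := zpow_le_zpow_right₀ hp1.le (by linarith)
      _ = (p : ℝ)⁻¹ := zpow_neg_one _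
  -- `‖Λ‖ = p^{−ord q}`, `‖b_{j₀}‖ = p^{−ord b_{j₀}}`
  have hΛ : ‖S.Λ‖ = (p : ℝ) ^ (-padicValRat p q) := by
    rw [S.norm_Λ_eq hprin, hcast, hnq]
  have hb : ‖(S.b S.j₀ : ℚ_[p])‖ = (p : ℝ) ^ (-(padicValInt p (S.b S.j₀) : ℤ)) := by
    have hb0 : ((S.b S.j₀ : ℚ) : ℚ_[p]) ≠ 0 := by exact_mod_cast S.bj₀_ne
    rw [show ((S.b S.j₀ : ℤ) : ℚ_[p]) = ((S.b S.j₀ : ℚ) : ℚ_[p]) by push_cast; rfl,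
      Padic.norm_eq_zpow_neg_valuation hb0, Padic.valuation_ratCast, padicValRat.of_int]
  rw [norm_div, hΛ, hb, ← zpow_sub₀ (by positivity), inv_pow, ← zpow_natCast, ← zpow_neg]
  exact zpow_le_zpow_right₀ hp1.le (by linarith)

end G3Setup

end Summit.ABC.StewartYu

end
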